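import Mathlib
import Literature.Algebra.GroupRings.Gardam2021.Promislow

/-! # Promislow's theorem: `P` is not a unique-product group — an explicit kernel-checked witness

Promislow (Bull. LMS 20 (1988) 302–304) showed that the Hantzsche–Wendt group
`P = ⟨a, b | b⁻¹a²b = a⁻², a⁻¹b²a = b⁻²⟩` fails the unique-product property, with a 14-element set `S`
such that `S·S` has no uniquely represented element.  Here we record a TWO-SIDED witness inside the
word ball of radius 3 (generators `a^{±1}, b^{±1}`): finite sets `A` (`|A| = 13`) and `B` (`|B| = 14`), both
containing `1`, such that every element of `A·B` has at least two representations `a·b`.  The pair was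
found by a SAT solver (kissat) on the encoding "every product occurs twice" of the searcher seat of the
`pub-kaplansky` cell (2026-08-18, job j041390) and is re-verified here by `decide` in the computable model
`Promislow.PElt` of Gardam's §3.1 (file `Promislow.lean`).  Minimal sizes of such witnesses inside balls of `P`
are the subject of Tabei, arXiv:2607.18346 (2026): the two-sided minimum of `|A|+|B|` inside radius 3 is 24,
so this pair (27 elements) is not minimal; nothing here is claimed to be new about `P`.

Consequence recorded: `¬ UniqueProds PElt` (Mathlib's `UniqueProds`).  This is NOT a statement about zero
divisors — `K[P]` is a domain for every field (Cliff 1980, Farkas–Snider 1976). -/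

namespace Literature.Algebra.GroupRings.Promislow

/-- The 13-element set `A ⊆ B(3)` of the two-sided non-unique-product witness (coordinates as in `PElt`:
`⟨i, j, k, s, t⟩ = xⁱ yʲ zᵏ · aˢ bᵗ`). [cite: Promislow1988] -/
def nupA : Finset PElt := {⟨0, 0, 0, false, false⟩, ⟨0, -1, 0, false, true⟩, ⟨0, 0, 0, false, true⟩, ⟨0, 0, 0, true, false⟩, ⟨-1, 1, 0, true, true⟩, ⟨0, 0, 0, true, true⟩, ⟨0, 0, -1, true, true⟩, ⟨0, 1, -1, true, true⟩, ⟨-1, 0, 0, false, false⟩, ⟨0, -1, 0, false, false⟩, ⟨0, 0, 1, false, true⟩, ⟨1, -1, 1, false, true⟩, ⟨-1, 1, 0, true, false⟩}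

/-- The 14-element set `B ⊆ B(3)` of the witness. [cite: Promislow1988] -/
def nupB : Finset PElt := {⟨0, 0, 0, false, false⟩, ⟨0, -1, 0, false, true⟩, ⟨-1, 0, 0, true, false⟩, ⟨0, 0, 0, true, false⟩, ⟨-1, 1, 0, true, true⟩, ⟨0, 0, 0, true, true⟩, ⟨0, 0, -1, true, true⟩, ⟨0, 1, -1, true, true⟩, ⟨0, 1, 0, false, false⟩, ⟨1, 0, 0, false, false⟩, ⟨0, -1, 1, false, true⟩, ⟨0, 0, 1, false, true⟩, ⟨1, 0, 0, false, true⟩, ⟨0, 1, 0, true, false⟩}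

/-- Sizes of the witness sets. [folklore] -/
theorem nupA_card : nupA.card = 13 ∧ nupB.card = 14 := by decide +kernel

/-- Every product `a·b`, `(a,b) ∈ A × B`, is attained by a second, different pair of `A × B`
(kernel-checked by `decide`). [cite: Promislow1988] -/
theorem nup_pair : ∀ p ∈ nupA ×ˢ nupB, ∃ q ∈ nupA ×ˢ nupB, q ≠ p ∧ q.1 * q.2 = p.1 * p.2 := by
  decide +kernel

/-- Promislow's theorem for the model `PElt` of `P`: `P` is not a unique-product group. [cite: Promislow1988] -/
theorem not_uniqueProds : ¬ UniqueProds PElt := by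
  intro h
  have hA : nupA.Nonempty := by decide +kernel
  have hB : nupB.Nonempty := by decide +kernel
  obtain ⟨a0, ha0, b0, hb0, hu⟩ := h.uniqueMul_of_nonempty hA hB
  obtain ⟨q, hq, hne, heq⟩ := nup_pair (a0, b0) (Finset.mem_product.2 ⟨ha0, hb0⟩)
  have h2 := hu (Finset.mem_product.1 hq).1 (Finset.mem_product.1 hq).2 heq
  exact hne (Prod.ext h2.1 h2.2)

end Literature.Algebra.GroupRings.Promislow
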